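import Summits.Ventures.CertifiedManyBodySolver.Upper.BlochDressedPeriodic
import Literature.MathematicalPhysics.QuantumLattice.HubbardTorusTTPrimePlaquetteDressedBound
import HarnessLib

/-!
# Ventures/CertifiedManyBodySolver — Upper/BlochDressedCornerWindowsTTPrime.lean

HONEST FRAMING: first certified bounds; not a superconductivity verdict; every number certified or labelled float.

THE CORNER WINDOW BLOCKS OF A BLOCH REFERENCE, `t–t'` PLAQUETTE-DRESSED SLATER FUNCTIONAL (hubbard-fast-atlas-2; step D(i) of the
`t–t'` twin of the chain `Upper/BlochDressed*.lean`; the plaquette and axial-link windows are the `t' = 0` file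
`Upper/BlochDressedPeriodic.lean` verbatim — a diagonal operator on the same window changes nothing there; theorem-only, nothing is
claimed). On the torus `(ℤ/2m)²` with an even magnetic cell (`M i = 2 q i`, `k i · M i = 2m`, `m ≥ 2`) and a Bloch family `G σ κ`:
* `cornerShift_zero_eq`, `cornerShift_shiftCell_one` — the two plaquettes of a corner window as UNIT SHIFTS of a base plaquette:
  kind `0`: `(c, c + e₀ + e₁)`; kind `1`, after the reindexing `c = b + e₁`: `(b + e₁, b + e₀)`;
* `blochMatrix_cornerSite_zero` / `blochMatrix_cornerSite_one` — the Bloch entries between the sites of a corner window: harmonics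
  `|k|⁻¹ Σ_κ χ_κ(δ − δ') G κ` with the cell-crossing vectors `δ ∈ {0, F₀ + F₁}` (kind `0`) resp. `δ ∈ {F₁, F₀}` (kind `1`),
  `F_j(r) = [r_j + 1 = q_j] e_j`, at the positions `a + 2·offset` of the respective plaquette;
* `cornerWindow_zero_eq_offset` / `cornerWindow_one_eq_offset` — the `16 × 16` corner window blocks of `P_G = spinBlock (σ ↦ blochMatrix G_σ)`
  as explicit matrices of harmonics depending on the plaquette only through its offset `r = c mod q`;
The periodic offset sums of the corner terms are the next file `Upper/BlochDressedPeriodicTTPrime.lean`.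
Sources: Bach–Lieb–Solovej 1994 eq. (3a.2) [BachLiebSolovej1994]. Everything is proved; no definition.
-/

noncomputable section

namespace Summit.Ventures.CertifiedManyBodySolver.Upper

open Matrix Finset
open Literature.MathematicalPhysics.QuantumLattice Literature.MathematicalPhysics.QuantumLattice.HartreeFock HeisenbergTL HubbardWave0
  PlaquetteLUC
open scoped ComplexConjugate

variable {m : ℕ} [NeZero m] {k M : Fin 2 → ℕ} [∀ i, NeZero (k i)] [∀ i, NeZero (M i)] {q : Fin 2 → ℕ}

/-! ### §0. Corner plaquettes as unit shifts -/

omit [∀ i, NeZero (k i)] [∀ i, NeZero (M i)] in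
/-- `c + (1,1) = (c + e₀) + e₁`. [folklore] -/
theorem cornerShift_zero_eq (c : Fin 2 → Fin m) : cornerShift c 0 = shiftCell (shiftCell c 0) 1 := by
  funext i
  fin_cases i
  · show cornerShift c 0 0 = shiftCell (shiftCell c 0) 1 0
    rw [cornerShift_apply_zero, shiftCell, shiftCell, Pi.add_apply, Pi.add_apply, Pi.single_eq_same,
      Pi.single_eq_of_ne (by decide : (0 : Fin 2) ≠ 1), add_zero]
  · show cornerShift c 0 1 = shiftCell (shiftCell c 0) 1 1
    rw [cornerShift_zero_apply_one, shiftCell, shiftCell, Pi.add_apply, Pi.add_apply, Pi.single_eq_same,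
      Pi.single_eq_of_ne (by decide : (1 : Fin 2) ≠ 0), add_zero]

omit [∀ i, NeZero (k i)] [∀ i, NeZero (M i)] in
/-- `(b + e₁) + (1,-1) = b + e₀`: the corner window of kind `1` based at `b + e₁` is the pair `(b + e₁, b + e₀)`. [folklore] -/
theorem cornerShift_shiftCell_one (b : Fin 2 → Fin m) : cornerShift (shiftCell b 1) 1 = shiftCell b 0 := by
  funext i
  fin_cases i
  · show cornerShift (shiftCell b 1) 1 0 = shiftCell b 0 0
    rw [cornerShift_apply_zero, shiftCell, shiftCell, Pi.add_apply, Pi.add_apply, Pi.single_eq_same,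
      Pi.single_eq_of_ne (by decide : (0 : Fin 2) ≠ 1), add_zero]
  · show cornerShift (shiftCell b 1) 1 1 = shiftCell b 0 1
    rw [cornerShift_one_apply_one, shiftCell, shiftCell, Pi.add_apply, Pi.add_apply, Pi.single_eq_same,
      Pi.single_eq_of_ne (by decide : (1 : Fin 2) ≠ 0), add_zero, add_sub_cancel_right]

omit [∀ i, NeZero (k i)] [∀ i, NeZero (M i)] in
/-- The transverse coordinate of a shifted plaquette is unchanged: `(c + e_j)_i = c_i` for `i ≠ j`. [folklore] -/
theorem shiftCell_apply_of_ne (c : Fin 2 → Fin m) {i j : Fin 2} (hij : i ≠ j) : shiftCell c j i = c i := by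
  rw [shiftCell, Pi.add_apply, Pi.single_eq_of_ne hij, add_zero]

omit [∀ i, NeZero (k i)] [∀ i, NeZero (M i)] in
/-- The offsets of `c + e₀ + e₁`: `(c_i + 1) mod q_i` in both directions. [folklore] -/
theorem mod_cornerShift_zero (hkM : ∀ i, k i * M i = m * 2) (hq : ∀ i, M i = 2 * q i) (hm : 2 ≤ m) (c : Fin 2 → Fin m)
    (i : Fin 2) : ((cornerShift c 0 i : Fin m) : ℕ) % q i = ((c i : ℕ) + 1) % q i := by
  rw [cornerShift_zero_eq, mod_shiftCell hkM hq hm]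
  by_cases hi : i = 1
  · subst hi
    rw [if_pos rfl, shiftCell_apply_of_ne c (by decide : (1 : Fin 2) ≠ 0)]
  · have hi0 : i = 0 := by fin_cases i <;> simp_all
    subst hi0
    rw [if_neg hi, mod_shiftCell hkM hq hm, if_pos rfl]

/-- **The cell of the diagonal neighbour** `c + (1,1)`: the cell index of its sites is that of the sites of `c` plus `e₀` when the
step crosses the `0`-face (`c₀ mod q₀ + 1 = q₀`) plus `e₁` when it crosses the `1`-face. [folklore] -/
theorem cellIndex_cellSite_cornerShift_zero (hkM : ∀ i, k i * M i = m * 2) (hq : ∀ i, M i = 2 * q i) (hm : 2 ≤ m)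
    (c : Fin 2 → Fin m) (a b : FermionTorus 2 2) :
    cellIndex hkM (cellSite (cornerShift c 0) b) = cellIndex hkM (cellSite c a) +
      ((if (c 0 : ℕ) % q 0 + 1 < q 0 then 0 else Pi.single 0 1) + (if (c 1 : ℕ) % q 1 + 1 < q 1 then 0 else Pi.single 1 1)) := by
  rw [cornerShift_zero_eq, cellIndex_cellSite_shiftCell hkM hq hm (shiftCell c 0) 1 a b,
    cellIndex_cellSite_shiftCell hkM hq hm c 0 a a, shiftCell_apply_of_ne c (by decide : (1 : Fin 2) ≠ 0), add_assoc]

/-! ### §1. Bloch entries and window blocks of the corner windows -/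

/-- **Entries between the two plaquettes of a corner window of kind `0`** (`c`, `c + (1,1)`): cell-crossing vectors
`δ(p) = [p in copy 1](F₀ + F₁)`, `F_j = [c_j mod q_j + 1 = q_j] e_j`, positions `a + 2r` resp. `a + 2((r + 1) mod q)`. [cite: BachLiebSolovej1994, eq. (3a.2)] -/
theorem blochMatrix_cornerSite_zero (hkM : ∀ i, k i * M i = m * 2) (hq : ∀ i, M i = 2 * q i) (hm : 2 ≤ m)
    (G : RectTorusSite k → Matrix (RectTorusSite M) (RectTorusSite M) ℂ) (c : Fin 2 → Fin m)
    (p p' : Fin 2 ×ₗ FermionTorus 2 2) :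
    blochMatrix hkM G (cornerEmb hm c 0 p) (cornerEmb hm c 0 p') = ((Fintype.card (RectTorusSite k) : ℂ))⁻¹ *
      ∑ κ, blockChar κ
          ((if (ofLex p).1 = 0 then (0 : RectTorusSite k) else
              ((if (c 0 : ℕ) % q 0 + 1 < q 0 then 0 else Pi.single 0 1) + (if (c 1 : ℕ) % q 1 + 1 < q 1 then 0 else Pi.single 1 1))) -
            (if (ofLex p').1 = 0 then (0 : RectTorusSite k) else
              ((if (c 0 : ℕ) % q 0 + 1 < q 0 then 0 else Pi.single 0 1) + (if (c 1 : ℕ) % q 1 + 1 < q 1 then 0 else Pi.single 1 1)))) *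
        G κ (fun i => (((ofLex (ofLex p).2 i : ℕ) + 2 * (if (ofLex p).1 = 0 then (c i : ℕ) % q i else ((c i : ℕ) + 1) % q i) : ℕ) :
              ZMod (M i)))
          (fun i => (((ofLex (ofLex p').2 i : ℕ) + 2 * (if (ofLex p').1 = 0 then (c i : ℕ) % q i else ((c i : ℕ) + 1) % q i) : ℕ) :
              ZMod (M i))) := by
  have hidx : ∀ pp : Fin 2 ×ₗ FermionTorus 2 2, cellIndex hkM (cornerEmb hm c 0 pp) = cellIndex hkM (cellSite c (ofLex pp).2) +
      (if (ofLex pp).1 = 0 then (0 : RectTorusSite k) else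
        ((if (c 0 : ℕ) % q 0 + 1 < q 0 then 0 else Pi.single 0 1) + (if (c 1 : ℕ) % q 1 + 1 < q 1 then 0 else Pi.single 1 1))) := by
    intro pp
    rw [cornerEmb_apply]
    by_cases h0 : (ofLex pp).1 = 0
    · rw [if_pos h0, if_pos h0, add_zero]
    · rw [if_neg h0, if_neg h0]
      exact cellIndex_cellSite_cornerShift_zero hkM hq hm c (ofLex pp).2 (ofLex pp).2
  have hpos : ∀ pp : Fin 2 ×ₗ FermionTorus 2 2, cellPos hkM (cornerEmb hm c 0 pp) =
      fun i => (((ofLex (ofLex pp).2 i : ℕ) + 2 * (if (ofLex pp).1 = 0 then (c i : ℕ) % q i else ((c i : ℕ) + 1) % q i) : ℕ) :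
        ZMod (M i)) := by
    intro pp
    rw [cornerEmb_apply]
    by_cases h0 : (ofLex pp).1 = 0
    · simp only [if_pos h0]
      exact cellPos_cellSite hkM hq c _
    · simp only [if_neg h0]
      rw [cellPos_cellSite hkM hq]
      funext i
      rw [mod_cornerShift_zero hkM hq hm]
  rw [blochMatrix_apply, hidx p, hidx p', hpos p, hpos p', cellIndex_cellSite_eq hkM hq c (ofLex p).2 (ofLex p').2]
  congr 1
  refine Finset.sum_congr rfl fun κ _ => ?_
  congr 2
  abel

/-- **Entries between the two plaquettes of a corner window of kind `1` based at `b + e₁`** (`b + e₁`, `b + e₀`): cell-crossing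
vectors `F₁(b)` (copy `0`) and `F₀(b)` (copy `1`), positions `a + 2·(offset of b shifted in direction 1 resp. 0)`. [cite: BachLiebSolovej1994, eq. (3a.2)] -/
theorem blochMatrix_cornerSite_one (hkM : ∀ i, k i * M i = m * 2) (hq : ∀ i, M i = 2 * q i) (hm : 2 ≤ m)
    (G : RectTorusSite k → Matrix (RectTorusSite M) (RectTorusSite M) ℂ) (b : Fin 2 → Fin m)
    (p p' : Fin 2 ×ₗ FermionTorus 2 2) :
    blochMatrix hkM G (cornerEmb hm (shiftCell b 1) 1 p) (cornerEmb hm (shiftCell b 1) 1 p') =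
      ((Fintype.card (RectTorusSite k) : ℂ))⁻¹ * ∑ κ, blockChar κ
          ((if (ofLex p).1 = 0 then (if (b 1 : ℕ) % q 1 + 1 < q 1 then (0 : RectTorusSite k) else Pi.single 1 1) else
              (if (b 0 : ℕ) % q 0 + 1 < q 0 then (0 : RectTorusSite k) else Pi.single 0 1)) -
            (if (ofLex p').1 = 0 then (if (b 1 : ℕ) % q 1 + 1 < q 1 then (0 : RectTorusSite k) else Pi.single 1 1) else
              (if (b 0 : ℕ) % q 0 + 1 < q 0 then (0 : RectTorusSite k) else Pi.single 0 1))) *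
        G κ (fun i => (((ofLex (ofLex p).2 i : ℕ) + 2 * (if i = (if (ofLex p).1 = 0 then 1 else 0) then ((b i : ℕ) + 1) % q i
              else (b i : ℕ) % q i) : ℕ) : ZMod (M i)))
          (fun i => (((ofLex (ofLex p').2 i : ℕ) + 2 * (if i = (if (ofLex p').1 = 0 then 1 else 0) then ((b i : ℕ) + 1) % q i
              else (b i : ℕ) % q i) : ℕ) : ZMod (M i))) := by
  have hsite : ∀ pp : Fin 2 ×ₗ FermionTorus 2 2, cornerEmb hm (shiftCell b 1) 1 pp =
      cellSite (shiftCell b (if (ofLex pp).1 = 0 then 1 else 0)) (ofLex pp).2 := by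
    intro pp
    rw [cornerEmb_apply, cornerShift_shiftCell_one]
    split_ifs <;> rfl
  have hidx : ∀ pp : Fin 2 ×ₗ FermionTorus 2 2, cellIndex hkM (cornerEmb hm (shiftCell b 1) 1 pp) =
      cellIndex hkM (cellSite b (ofLex pp).2) +
        (if (ofLex pp).1 = 0 then (if (b 1 : ℕ) % q 1 + 1 < q 1 then (0 : RectTorusSite k) else Pi.single 1 1) else
          (if (b 0 : ℕ) % q 0 + 1 < q 0 then (0 : RectTorusSite k) else Pi.single 0 1)) := by
    intro pp
    rw [hsite pp]
    by_cases h0 : (ofLex pp).1 = 0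
    · simp only [h0, ↓reduceIte]
      exact cellIndex_cellSite_shiftCell hkM hq hm b 1 (ofLex pp).2 (ofLex pp).2
    · simp only [h0, ↓reduceIte]
      exact cellIndex_cellSite_shiftCell hkM hq hm b 0 (ofLex pp).2 (ofLex pp).2
  have hpos : ∀ pp : Fin 2 ×ₗ FermionTorus 2 2, cellPos hkM (cornerEmb hm (shiftCell b 1) 1 pp) =
      fun i => (((ofLex (ofLex pp).2 i : ℕ) + 2 * (if i = (if (ofLex pp).1 = 0 then 1 else 0) then ((b i : ℕ) + 1) % q i
        else (b i : ℕ) % q i) : ℕ) : ZMod (M i)) := by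
    intro pp
    rw [hsite pp, cellPos_cellSite hkM hq]
    funext i
    rw [mod_shiftCell hkM hq hm]
    by_cases hi : i = (if (ofLex pp).1 = 0 then 1 else 0)
    · rw [if_pos hi, if_pos hi, hi]
    · rw [if_neg hi, if_neg hi]
  rw [blochMatrix_apply, hidx p, hidx p', hpos p, hpos p', cellIndex_cellSite_eq hkM hq b (ofLex p).2 (ofLex p').2]
  congr 1
  refine Finset.sum_congr rfl fun κ _ => ?_
  congr 2
  abel

/-- **The corner window block of kind `0`** of a collinear Bloch one-body matrix, as an explicit matrix of harmonics at the offset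
`r = c mod q`. [cite: BachLiebSolovej1994, eq. (3a.2)] -/
theorem cornerWindow_zero_eq_offset (hkM : ∀ i, k i * M i = m * 2) (hq : ∀ i, M i = 2 * q i) (hm : 2 ≤ m)
    (G : Fin 2 → RectTorusSite k → Matrix (RectTorusSite M) (RectTorusSite M) ℂ) (c : Fin 2 → Fin m) :
    (spinBlock fun σ => blochMatrix hkM (G σ)).submatrix
        (fun a : Orb (Fin 2 ×ₗ FermionTorus 2 2) => orb (cornerEmb hm c 0 (ofLex a).1) (ofLex a).2)
        (fun a => orb (cornerEmb hm c 0 (ofLex a).1) (ofLex a).2) =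
      Matrix.of fun o o' : Orb (Fin 2 ×ₗ FermionTorus 2 2) => if (ofLex o).2 = (ofLex o').2 then
        ((Fintype.card (RectTorusSite k) : ℂ))⁻¹ * ∑ κ, blockChar κ
          ((if (ofLex (ofLex o).1).1 = 0 then (0 : RectTorusSite k) else
              ((if (c 0 : ℕ) % q 0 + 1 < q 0 then 0 else Pi.single 0 1) + (if (c 1 : ℕ) % q 1 + 1 < q 1 then 0 else Pi.single 1 1))) -
            (if (ofLex (ofLex o').1).1 = 0 then (0 : RectTorusSite k) else
              ((if (c 0 : ℕ) % q 0 + 1 < q 0 then 0 else Pi.single 0 1) + (if (c 1 : ℕ) % q 1 + 1 < q 1 then 0 else Pi.single 1 1)))) *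
          G (ofLex o).2 κ
            (fun i => (((ofLex (ofLex (ofLex o).1).2 i : ℕ) + 2 * (if (ofLex (ofLex o).1).1 = 0 then (c i : ℕ) % q i else
              ((c i : ℕ) + 1) % q i) : ℕ) : ZMod (M i)))
            (fun i => (((ofLex (ofLex (ofLex o').1).2 i : ℕ) + 2 * (if (ofLex (ofLex o').1).1 = 0 then (c i : ℕ) % q i else
              ((c i : ℕ) + 1) % q i) : ℕ) : ZMod (M i))) else 0 := by
  ext o o'
  obtain ⟨p, σ, rfl⟩ := exists_eq_orb o
  obtain ⟨p', σ', rfl⟩ := exists_eq_orb o'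
  simp only [Matrix.submatrix_apply, Matrix.of_apply, orb, ofLex_toLex, spinBlock_orb]
  by_cases h : σ = σ'
  · subst h
    rw [if_pos rfl, if_pos rfl]
    exact blochMatrix_cornerSite_zero hkM hq hm (G σ) c p p'
  · rw [if_neg h, if_neg h]

/-- **The corner window block of kind `1` based at `b + e₁`**, as an explicit matrix of harmonics at the offset `r = b mod q`.
[cite: BachLiebSolovej1994, eq. (3a.2)] -/
theorem cornerWindow_one_eq_offset (hkM : ∀ i, k i * M i = m * 2) (hq : ∀ i, M i = 2 * q i) (hm : 2 ≤ m)
    (G : Fin 2 → RectTorusSite k → Matrix (RectTorusSite M) (RectTorusSite M) ℂ) (b : Fin 2 → Fin m) :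
    (spinBlock fun σ => blochMatrix hkM (G σ)).submatrix
        (fun a : Orb (Fin 2 ×ₗ FermionTorus 2 2) => orb (cornerEmb hm (shiftCell b 1) 1 (ofLex a).1) (ofLex a).2)
        (fun a => orb (cornerEmb hm (shiftCell b 1) 1 (ofLex a).1) (ofLex a).2) =
      Matrix.of fun o o' : Orb (Fin 2 ×ₗ FermionTorus 2 2) => if (ofLex o).2 = (ofLex o').2 then
        ((Fintype.card (RectTorusSite k) : ℂ))⁻¹ * ∑ κ, blockChar κ
          ((if (ofLex (ofLex o).1).1 = 0 then (if (b 1 : ℕ) % q 1 + 1 < q 1 then (0 : RectTorusSite k) else Pi.single 1 1) else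
              (if (b 0 : ℕ) % q 0 + 1 < q 0 then (0 : RectTorusSite k) else Pi.single 0 1)) -
            (if (ofLex (ofLex o').1).1 = 0 then (if (b 1 : ℕ) % q 1 + 1 < q 1 then (0 : RectTorusSite k) else Pi.single 1 1) else
              (if (b 0 : ℕ) % q 0 + 1 < q 0 then (0 : RectTorusSite k) else Pi.single 0 1))) *
          G (ofLex o).2 κ
            (fun i => (((ofLex (ofLex (ofLex o).1).2 i : ℕ) + 2 * (if i = (if (ofLex (ofLex o).1).1 = 0 then 1 else 0) then
              ((b i : ℕ) + 1) % q i else (b i : ℕ) % q i) : ℕ) : ZMod (M i)))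
            (fun i => (((ofLex (ofLex (ofLex o').1).2 i : ℕ) + 2 * (if i = (if (ofLex (ofLex o').1).1 = 0 then 1 else 0) then
              ((b i : ℕ) + 1) % q i else (b i : ℕ) % q i) : ℕ) : ZMod (M i))) else 0 := by
  ext o o'
  obtain ⟨p, σ, rfl⟩ := exists_eq_orb o
  obtain ⟨p', σ', rfl⟩ := exists_eq_orb o'
  simp only [Matrix.submatrix_apply, Matrix.of_apply, orb, ofLex_toLex, spinBlock_orb]
  by_cases h : σ = σ'
  · subst h
    rw [if_pos rfl, if_pos rfl]
    exact blochMatrix_cornerSite_one hkM hq hm (G σ) b p p'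
  · rw [if_neg h, if_neg h]

end Summit.Ventures.CertifiedManyBodySolver.Upper
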